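import Summits.Ventures.GridStability.Bench.WSCC9Deg4ASosgramDinstKslicesA
import Summits.Ventures.GridStability.Bench.WSCC9Deg4ASosgramDinstKslicesB
import Summits.Ventures.GridStability.Bench.WSCC9Deg4ASosgramDinstKslicesC
import Summits.Ventures.GridStability.Bench.WSCC9Deg4ASosgramDinstKslicesD
import Mathlib.Tactic.IntervalCases
import HarnessLib

/-!
# «K(T) ⊂ S_deg4 for EVERY clearing time T ≤ 1/12 s» — the THRESHOLD form of row «G1cct-WSCC9-LOWER-K» (rider token
# «LOWER-K ∀T ≤ 1/12»), closed in the kernel by 40 time-slice hull boxes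

Venture GRIDFUSION, LINE «G1cct-WSCC9-THRESH-K» (lead RULING THRESH-K 2026-08-27T08:15:44Z (2): threshold form second, «by a
split … inside the decide», ≤ 20 farm-min); seat gridfusion-sos-3 (g4). WHY SLICES AND NOT THE UNION BOX (sos-3 INBOX 09:0xZ,
HOME/cert/sos-3/kbox/ubox_size.py): the union box `U(1/12)` of model-1's `hKSU` (p513111) is TRUE (`sup_U V ≈ 1.072`) but not
certifiable by interval evaluation — the recast product box of its 0.17 rad × 0.11 rad angle box leaves the circle (max of `V`
over the z-box corners 1.28 > 1.159) and its v-frame speed ranges `v₂ ∈ [−5.96, −1.95]`, `v₃ ∈ [−5.96, −3.49]` decorrelate the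
253-term `V` (natural extension 5.06; 2.5 with 64 sub-boxes). The cross-sections `K(T)` themselves are narrow; their hulls over
40 time slices pass with margin ≥ 0.038 (`Bench/WSCC9Deg4ASosgramDinstKslices{A,B,C,D}.lean`: `Kslice k`, `Kslice k_checkLe`).

CONTENTS. `tubeLoQ`/`tubeHiQ` (ℚ copies of the tube literals, `= WSCC9.tubeLo/tubeHi` after cast); `KBox.sliceOK B Ta Tb` (Bool:
`0 ≤ Ta ≤ Tb` and B's corners dominate the slice-hull formulas `a2W.lo + (lo₂−hi₁)Ta²/2`, `a2W.hi + (hi₂−lo₁)Tb²/2`, …,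
`tubeLo_j Ta − ω∞′`, `tubeHi_j Tb − ω∞′`); `KBox.mem_of_sliceOK` (a state reached at a clearing time `T ∈ [Ta, Tb]` under the
tube's conclusion shape lies in `B`); the table `slices = [Kslice0, …, Kslice39]` with `slices_checkLe` (from the 40 kernel facts)
and `slices_sliceOK` (40 small `decide`s: the literal corners ARE the formulas at `Ta = k/480`, `Tb = (k+1)/480`); and the CLOSED
threshold sentence `clearing_le_5cycles_returns`: for every `T ∈ [0, 1/12]`, every fault-on solution of `WSCC9.faultBus7Printed`
on `[0, T]` from the printed pre-fault point at synchronous speed, and every post-fault solution of `WSCC9.postB_SPdamp.toModel` on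
`[0, ∞)` from the state cleared at `T`: no relative angle deviation ever reaches `±π`, `u_i → 0`, speeds `→ 0` — via
`Literature.Analysis.ODE.exists_slice_of_mem_Icc` (lit-1, p511448) ∘ tube `WSCC9.faultBus7_tube` (model-1, p510936) at `T` ∘
`mem_of_sliceOK` ∘ `deg4_A_sosgram_Dinst_roa_of_kbox` (`Bench/WSCC9Deg4ASosgramDinstKbox.lean`).

THREE COLUMNS. CERTIFIED: the kernel facts (40 interval evaluations + the D-instance identities via p509641/p509956 + the tube).
VALIDATED (not here): G1-LOG RK4 «every t_cl ≤ 0.09 s returns, first exit t* = 0.123 s»; model-4's exact tables. MODELLED: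
classical WSCC9 M′ (MV-2 + MV-P + MV-SPD + MV-ω + MV-h12; bolted bus-7 fault cleared by opening line 5–7; printed pre-fault point
at synchronous speed). Honest framing (RULING 27 (B)): «every clearing time t_cl ≤ 1/12 s (5 cycles) returns, FOR M′» is a kernel
LOWER bound on the clearing time of the model beside Anderson–Fouad's simulated 5-cycle case — never «the CCT», never «the grid is
stable». model-1's union-box receptacle `Bench.wscc9_clearing_le_5cycles_returns_of_KSU` (p513111) stays undischarged (not needed).
-/

noncomputable section

open Real Set Filter Topology
open Literature.Computation.Certificates Literature.Computation.Certificates.SOS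
open Summit.Ventures.GridStability.Models Summit.Ventures.GridStability.Lyapunov

namespace Summit.Ventures.GridStability.Bench.WSCC9

/-! ### §1 Slice membership -/

/-- ℚ copy of `WSCC9.tubeLo` = `(131/500, 11797/250, 5997/250)` rad/s². [folklore] -/
def tubeLoQ : Fin 3 → ℚ := ![131 / 500, 11797 / 250, 5997 / 250]

/-- ℚ copy of `WSCC9.tubeHi` = `(223/250, 48009/1000, 29611/1000)` rad/s². [folklore] -/
def tubeHiQ : Fin 3 → ℚ := ![223 / 250, 48009 / 1000, 29611 / 1000]

/-- `tubeLoQ` casts to `WSCC9.tubeLo`. [folklore] -/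
theorem tubeLoQ_cast (i : Fin 3) : ((tubeLoQ i : ℚ) : ℝ) = WSCC9.tubeLo i := by
  fin_cases i <;>
    simp [tubeLoQ, WSCC9.tubeLo, Matrix.cons_val_zero, Matrix.cons_val_one, Matrix.cons_val_two, Matrix.head_cons,
      Matrix.tail_cons]

/-- `tubeHiQ` casts to `WSCC9.tubeHi`. [folklore] -/
theorem tubeHiQ_cast (i : Fin 3) : ((tubeHiQ i : ℚ) : ℝ) = WSCC9.tubeHi i := by
  fin_cases i <;>
    simp [tubeHiQ, WSCC9.tubeHi, Matrix.cons_val_zero, Matrix.cons_val_one, Matrix.cons_val_two, Matrix.head_cons,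
      Matrix.tail_cons]

namespace KBox

/-- Side test «`B` contains the slice hull over clearing times `[Ta, Tb]`»: `0 ≤ Ta ≤ Tb` and the corners of `B` dominate
the monotone tube corners `a2W.lo + (lo₂−hi₁)Ta²/2`, `a2W.hi + (hi₂−lo₁)Tb²/2`, `a3W.lo + (lo₃−hi₁)Ta²/2`,
`a3W.hi + (hi₃−lo₁)Tb²/2`, `tubeLo_j·Ta − ω∞′`, `tubeHi_j·Tb − ω∞′`. [folklore] -/
def sliceOK (B : KBox) (Ta Tb : ℚ) : Bool :=
  decide (0 ≤ Ta) && decide (Ta ≤ Tb) &&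
  decide (B.a2lo ≤ 7617 / 25000 + (tubeLoQ 1 - tubeHiQ 0) * Ta ^ 2 / 2) &&
  decide (15239 / 50000 + (tubeHiQ 1 - tubeLoQ 0) * Tb ^ 2 / 2 ≤ B.a2hi) &&
  decide (B.a3lo ≤ 761 / 4000 + (tubeLoQ 2 - tubeHiQ 0) * Ta ^ 2 / 2) &&
  decide (3807 / 20000 + (tubeHiQ 2 - tubeLoQ 0) * Tb ^ 2 / 2 ≤ B.a3hi) &&
  decide (B.vlo 0 ≤ tubeLoQ 0 * Ta - WSCC9.omegaInf) && decide (tubeHiQ 0 * Tb - WSCC9.omegaInf ≤ B.vhi 0) &&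
  decide (B.vlo 1 ≤ tubeLoQ 1 * Ta - WSCC9.omegaInf) && decide (tubeHiQ 1 * Tb - WSCC9.omegaInf ≤ B.vhi 1) &&
  decide (B.vlo 2 ≤ tubeLoQ 2 * Ta - WSCC9.omegaInf) && decide (tubeHiQ 2 * Tb - WSCC9.omegaInf ≤ B.vhi 2)

/-- Unpacking `sliceOK` into its twelve rational inequalities (literals evaluated). [folklore] -/
theorem sliceOK_spec {B : KBox} {Ta Tb : ℚ} (h : B.sliceOK Ta Tb = true) :
    (0 ≤ Ta ∧ Ta ≤ Tb) ∧
    (B.a2lo ≤ 7617 / 25000 + (11797 / 250 - 223 / 250) * Ta ^ 2 / 2 ∧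
      15239 / 50000 + (48009 / 1000 - 131 / 500) * Tb ^ 2 / 2 ≤ B.a2hi) ∧
    (B.a3lo ≤ 761 / 4000 + (5997 / 250 - 223 / 250) * Ta ^ 2 / 2 ∧
      3807 / 20000 + (29611 / 1000 - 131 / 500) * Tb ^ 2 / 2 ≤ B.a3hi) ∧
    (B.vlo 0 ≤ 131 / 500 * Ta - WSCC9.omegaInf ∧ 223 / 250 * Tb - WSCC9.omegaInf ≤ B.vhi 0) ∧
    (B.vlo 1 ≤ 11797 / 250 * Ta - WSCC9.omegaInf ∧ 48009 / 1000 * Tb - WSCC9.omegaInf ≤ B.vhi 1) ∧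
    (B.vlo 2 ≤ 5997 / 250 * Ta - WSCC9.omegaInf ∧ 29611 / 1000 * Tb - WSCC9.omegaInf ≤ B.vhi 2) := by
  simp only [sliceOK, Bool.and_eq_true, decide_eq_true_eq, tubeLoQ, tubeHiQ, Matrix.cons_val_zero, Matrix.cons_val_one,
    Matrix.cons_val_two, Matrix.head_cons, Matrix.tail_cons] at h
  obtain ⟨⟨⟨⟨⟨⟨⟨⟨⟨⟨⟨hTa0, hTab⟩, h2l⟩, h2u⟩, h3l⟩, h3u⟩, hv0l⟩, hv0u⟩, hv1l⟩, hv1u⟩, hv2l⟩, hv2u⟩ := h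
  exact ⟨⟨hTa0, hTab⟩, ⟨h2l, h2u⟩, ⟨h3l, h3u⟩, ⟨hv0l, hv0u⟩, ⟨hv1l, hv1u⟩, ⟨hv2l, hv2u⟩⟩

/-- **Slice membership.** If `B.sliceOK Ta Tb` and a state `x` was reached at a clearing time `T ∈ [Ta, Tb]` under the tube's
conclusion shape (angle increments `Δ_i ∈ [tubeLo_i, tubeHi_i]·T²/2` from pre-fault angles `δ0` with relative angles in the printed
windows; printed-frame speeds `x.2 j + ω∞′ ∈ [tubeLo_j, tubeHi_j]·T`), then `x ∈ B`. [folklore] -/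
theorem mem_of_sliceOK (B : KBox) {Ta Tb : ℚ} (h : B.sliceOK Ta Tb = true) {T : ℝ} (hTa : (Ta : ℝ) ≤ T)
    (hTb : T ≤ Tb) (x : ClassicalSwing.State 3) (δ0 : Fin 3 → ℝ)
    (ha2 : δ0 1 - δ0 0 ∈ WSCC9.a2Window) (ha3 : δ0 2 - δ0 0 ∈ WSCC9.a3Window)
    (hΔ : ∀ i : Fin 3, WSCC9.tubeLo i * T ^ 2 / 2 ≤ x.1 i - δ0 i ∧ x.1 i - δ0 i ≤ WSCC9.tubeHi i * T ^ 2 / 2)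
    (hω : ∀ i : Fin 3, WSCC9.tubeLo i * T ≤ x.2 i + WSCC9.omegaInf ∧ x.2 i + WSCC9.omegaInf ≤ WSCC9.tubeHi i * T) :
    x ∈ B.toSet := by
  obtain ⟨⟨hTa0, -⟩, ⟨h2l, h2u⟩, ⟨h3l, h3u⟩, ⟨hv0l, hv0u⟩, ⟨hv1l, hv1u⟩, ⟨hv2l, hv2u⟩⟩ := sliceOK_spec h
  have hTa0' : (0 : ℝ) ≤ Ta := by exact_mod_cast hTa0
  have hT0 : (0 : ℝ) ≤ T := le_trans hTa0' hTa
  have hsa : (Ta : ℝ) ^ 2 ≤ T ^ 2 := pow_le_pow_left₀ hTa0' hTa 2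
  have hsb : T ^ 2 ≤ (Tb : ℝ) ^ 2 := pow_le_pow_left₀ hT0 hTb 2
  obtain ⟨ha2l, ha2u⟩ := ha2
  obtain ⟨ha3l, ha3u⟩ := ha3
  have d0 := hΔ 0; have d1 := hΔ 1; have d2 := hΔ 2
  have w0 := hω 0; have w1 := hω 1; have w2 := hω 2
  simp only [WSCC9.tubeLo, WSCC9.tubeHi, Matrix.cons_val_zero, Matrix.cons_val_one, Matrix.head_cons,
    Matrix.cons_val_two, Matrix.tail_cons] at d0 d1 d2 w0 w1 w2
  -- the twelve side facts cast to ℝ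
  have c2l := (Rat.cast_le (K := ℝ)).2 h2l
  have c2u := (Rat.cast_le (K := ℝ)).2 h2u
  have c3l := (Rat.cast_le (K := ℝ)).2 h3l
  have c3u := (Rat.cast_le (K := ℝ)).2 h3u
  have e0l := (Rat.cast_le (K := ℝ)).2 hv0l
  have e0u := (Rat.cast_le (K := ℝ)).2 hv0u
  have e1l := (Rat.cast_le (K := ℝ)).2 hv1l
  have e1u := (Rat.cast_le (K := ℝ)).2 hv1u
  have e2l := (Rat.cast_le (K := ℝ)).2 hv2l
  have e2u := (Rat.cast_le (K := ℝ)).2 hv2u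
  push_cast at c2l c2u c3l c3u e0l e0u e1l e1u e2l e2u
  -- monotone corner facts (linear in the atoms Ta², T², Tb², Ta, T, Tb)
  have m1 := mul_le_mul_of_nonneg_left hsa (show (0 : ℝ) ≤ (11797 / 250 - 223 / 250) / 2 by norm_num)
  have m2 := mul_le_mul_of_nonneg_left hsb (show (0 : ℝ) ≤ (48009 / 1000 - 131 / 500) / 2 by norm_num)
  have m3 := mul_le_mul_of_nonneg_left hsa (show (0 : ℝ) ≤ (5997 / 250 - 223 / 250) / 2 by norm_num)
  have m4 := mul_le_mul_of_nonneg_left hsb (show (0 : ℝ) ≤ (29611 / 1000 - 131 / 500) / 2 by norm_num)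
  have s0a := mul_le_mul_of_nonneg_left hTa (show (0 : ℝ) ≤ 131 / 500 by norm_num)
  have s0b := mul_le_mul_of_nonneg_left hTb (show (0 : ℝ) ≤ 223 / 250 by norm_num)
  have s1a := mul_le_mul_of_nonneg_left hTa (show (0 : ℝ) ≤ 11797 / 250 by norm_num)
  have s1b := mul_le_mul_of_nonneg_left hTb (show (0 : ℝ) ≤ 48009 / 1000 by norm_num)
  have s2a := mul_le_mul_of_nonneg_left hTa (show (0 : ℝ) ≤ 5997 / 250 by norm_num)
  have s2b := mul_le_mul_of_nonneg_left hTb (show (0 : ℝ) ≤ 29611 / 1000 by norm_num)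
  rw [mem_toSet_iff]
  refine ⟨⟨?_, ?_⟩, ⟨?_, ?_⟩, fun j => ?_⟩
  · linarith only [c2l, m1, d1.1, d0.2, ha2l]
  · linarith only [c2u, m2, d1.2, d0.1, ha2u]
  · linarith only [c3l, m3, d2.1, d0.2, ha3l]
  · linarith only [c3u, m4, d2.2, d0.1, ha3u]
  · fin_cases j
    · change (B.vlo 0 : ℝ) ≤ x.2 0 ∧ x.2 0 ≤ (B.vhi 0 : ℝ)
      exact ⟨by linarith only [e0l, s0a, w0.1], by linarith only [e0u, s0b, w0.2]⟩
    · change (B.vlo 1 : ℝ) ≤ x.2 1 ∧ x.2 1 ≤ (B.vhi 1 : ℝ)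
      exact ⟨by linarith only [e1l, s1a, w1.1], by linarith only [e1u, s1b, w1.2]⟩
    · change (B.vlo 2 : ℝ) ≤ x.2 2 ∧ x.2 2 ≤ (B.vhi 2 : ℝ)
      exact ⟨by linarith only [e2l, s2a, w2.1], by linarith only [e2u, s2b, w2.2]⟩

end KBox

/-! ### §2 The table of 40 slice hull boxes and its two kernel properties -/

/-- The 40 slice hull boxes `H_0, …, H_39` (`T ∈ [k/480, (k+1)/480]` s). [folklore] -/
def slices : List KBox := [Kslice0, Kslice1, Kslice2, Kslice3, Kslice4, Kslice5, Kslice6, Kslice7, Kslice8, Kslice9, Kslice10, Kslice11, Kslice12, Kslice13, Kslice14, Kslice15, Kslice16, Kslice17, Kslice18, Kslice19, Kslice20, Kslice21, Kslice22, Kslice23, Kslice24, Kslice25, Kslice26, Kslice27, Kslice28, Kslice29, Kslice30, Kslice31, Kslice32, Kslice33, Kslice34, Kslice35, Kslice36, Kslice37, Kslice38, Kslice39]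

/-- Every slice box passes the kernel test against `V` (the 40 facts `Kslice k_checkLe`). [folklore] -/
theorem slices_checkLe : ∀ k, k < 40 → (slices.getD k K112).checkLe deg4_A_sosgram_Dinst_V_poly (1159 / 1000) = true := by
  intro k hk
  interval_cases k
  exacts [Kslice0_checkLe, Kslice1_checkLe, Kslice2_checkLe, Kslice3_checkLe, Kslice4_checkLe, Kslice5_checkLe, Kslice6_checkLe, Kslice7_checkLe, Kslice8_checkLe, Kslice9_checkLe, Kslice10_checkLe, Kslice11_checkLe, Kslice12_checkLe, Kslice13_checkLe, Kslice14_checkLe, Kslice15_checkLe, Kslice16_checkLe, Kslice17_checkLe, Kslice18_checkLe, Kslice19_checkLe, Kslice20_checkLe, Kslice21_checkLe, Kslice22_checkLe, Kslice23_checkLe, Kslice24_checkLe, Kslice25_checkLe, Kslice26_checkLe, Kslice27_checkLe, Kslice28_checkLe, Kslice29_checkLe, Kslice30_checkLe, Kslice31_checkLe, Kslice32_checkLe, Kslice33_checkLe, Kslice34_checkLe, Kslice35_checkLe, Kslice36_checkLe, Kslice37_checkLe, Kslice38_checkLe, Kslice39_checkLe]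

/-- Every slice box contains its slice hull: the literal corners dominate (indeed equal) the formulas at `Ta = k/480`,
`Tb = (k+1)/480` (40 small kernel `decide`s). [folklore] -/
theorem slices_sliceOK : ∀ k, k < 40 → (slices.getD k K112).sliceOK ((k : ℚ) / 480) (((k : ℚ) + 1) / 480) = true := by
  intro k hk
  interval_cases k <;> decide +kernel

/-! ### §3 The threshold sentence -/

/-- **Row «G1cct-WSCC9-LOWER-K», THRESHOLD form («LOWER-K ∀T ≤ 1/12»), CLOSED.** For every clearing time `T ∈ [0, 1/12 s]`,
every fault-on solution `Y` of `WSCC9.faultBus7Printed` (bus 7 grounded, printed frame) on `[0, T]` from the printed pre-fault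
point at synchronous speed (`ω(0) = 0`, `δ₂(0) − δ₁(0) ∈ a2Window`, `δ₃(0) − δ₁(0) ∈ a3Window`), and every post-fault solution
`c` of `WSCC9.postB_SPdamp.toModel` (line 5–7 opened) on `[0, ∞)` from the state cleared at `T` (`c 0 = (δ(T), ω(T) − ω∞′)`):
NO relative angle deviation ever reaches `±π` (no pole slip), every `u_i(t) → 0` and every speed deviation `→ 0`. Proof: slice
`k` with `T ∈ [k/480, (k+1)/480]` (`exists_slice_of_mem_Icc`), tube at `T` (`WSCC9.faultBus7_tube`), `c 0 ∈ H_k`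
(`KBox.mem_of_sliceOK`, `slices_sliceOK`), `H_k ⊂ S_deg4` (`slices_checkLe`), ROA (`deg4_A_sosgram_Dinst_roa_of_kbox`). MODELLED:
classical WSCC9 M′ (MV-2 + MV-P + MV-SPD + MV-ω + MV-h12); honest framing (RULING 27 (B)): a kernel LOWER bound «every
t_cl ≤ 1/12 s returns, FOR M′» beside Anderson–Fouad's simulated 5-cycle clearing — never «the CCT», never «the grid is stable».
[folklore] -/
theorem clearing_le_5cycles_returns {T : ℝ} (hT0 : 0 ≤ T) (hT : T ≤ 1 / 12)
    {Y : ℝ → ClassicalSwing.State 3} (hY : WSCC9.faultBus7Printed.IsSolutionOn Y (Icc 0 T))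
    (hω0 : (Y 0).2 = 0) (ha2 : (Y 0).1 1 - (Y 0).1 0 ∈ WSCC9.a2Window) (ha3 : (Y 0).1 2 - (Y 0).1 0 ∈ WSCC9.a3Window)
    {c : ℝ → ClassicalSwing.State 3} (hc : WSCC9.postB_SPdamp.toModel.IsSolutionOn c (Ici 0))
    (hc0 : c 0 = ((Y T).1, fun j => (Y T).2 j - (WSCC9.omegaInf : ℝ))) :
    (∀ i : Fin 2, ∀ t, 0 ≤ t → |RecastData.u WSCC9.postB_SPdamp.angleOf (c t) i.succ| < π) ∧
    (∀ i : Fin 2, Tendsto (fun t => RecastData.u WSCC9.postB_SPdamp.angleOf (c t) i.succ) atTop (𝓝 0)) ∧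
    (∀ j : Fin 3, Tendsto (fun t => (c t).2 j) atTop (𝓝 0)) := by
  obtain ⟨k, hk, h1, h2⟩ :=
    Literature.Analysis.ODE.exists_slice_of_mem_Icc (T := 1 / 12) (by norm_num) (N := 40) (by norm_num) (t := T) ⟨hT0, hT⟩
  have hN : ((40 : ℕ) : ℝ) = 40 := by norm_num
  rw [hN] at h1 h2
  have hTa : (((k : ℚ) / 480 : ℚ) : ℝ) ≤ T := by push_cast; linarith
  have hTb : T ≤ ((((k : ℚ) + 1) / 480 : ℚ) : ℝ) := by push_cast; linarith
  have htube := WSCC9.faultBus7_tube hT0 hT hY hω0 ha2 ha3 T ⟨hT0, le_rfl⟩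
  have hc01 : (c 0).1 = (Y T).1 := by rw [hc0]
  have hc02 : ∀ j, (c 0).2 j + (WSCC9.omegaInf : ℝ) = (Y T).2 j := by intro j; rw [hc0]; simp
  have hmem : c 0 ∈ (slices.getD k K112).toSet := by
    refine KBox.mem_of_sliceOK _ (slices_sliceOK k hk) hTa hTb (c 0) (Y 0).1 ha2 ha3 ?_ ?_
    · intro i; rw [hc01]; exact ⟨(htube i).2.2.1, (htube i).2.2.2⟩
    · intro i; rw [hc02]; exact ⟨(htube i).1, (htube i).2.1⟩
  exact (deg4_A_sosgram_Dinst_roa_of_kbox _ (slices_checkLe k hk) hc hmem).2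

end Summit.Ventures.GridStability.Bench.WSCC9

end
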